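import Mathlib
import Summits.ValiantsHypothesis.ValiantsHypothesis.Theorems.NewtonUnitEquationsTwoProductsDissocCount
import Summits.ValiantsHypothesis.ValiantsHypothesis.Theorems.NewtonUnitEquationsTwoProductsEchelonPivots
import Summits.ValiantsHypothesis.ValiantsHypothesis.Theorems.NewtonUnitEquationsTwoProductsResonanceDichotomy
import Summits.ValiantsHypothesis.ValiantsHypothesis.Theorems.NewtonUnitEquationsTwoProductsPencil

/-! # Rung `stub_engineNonResonant` — crux `TwoProducts` (stmt-ValiantsHypothesis-5906), line `corner-log-linearization`

THE NON-RESONANT ENGINE (lead c7; crux-shaped; composition of the landed echelon stub `stub_echelonPivots` (p132414), the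
landed resonance dichotomy `stub_resonanceDichotomy` (p132489) and the landed cell count `stub_dissocCount`).  For local
factors `u, v : Fin n → ℂ[X,Y]` with constant terms `1`, let `U` be the set of letters (nonzero support points of the `2n`
factors).  If `U` carries NO additive relation `Σ_ρ Δ_ρ • p_ρ = 0` among pairwise distinct letters `p_ρ` with integer
coefficients `0 < Σ|Δ_ρ| ≤ 2n`, then `∏ u − ∏ v` has at most `(|U|² + 2)·(2n+1)·4^{2n}` south-west vertices.

Proof: for a vertex `e` exposed by a positive weight `w`, choose — as a function of the WEAK ORDER of `w` on `U` only — a positive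
weight `w†` with the same weak order, and the echelon family of the tails for the refined weight `K·wt_{w†} + x` (`K = 1 + max x`
over `U`): generators `F_ρ` of the tail span with pairwise distinct strict pivots `p_ρ ∈ U`, `r ≤ 2n`, every tail a combination of
them.  The pivots are lexicographically strict for `w` as well (same weak order), so the dichotomy at `w` applies; its resonant
alternative is excluded by hypothesis, whence `e = Σ j_ρ • p_ρ` with `Σ j_ρ ≤ n`.  Feeding the pivot set (as `Rw w`) and the
multiset `Σ single (p_ρ) (j_ρ)` to the cell count gives the bound. [folklore] -/

set_option linter.dupNamespace false -- single-conjunct summit: `ValiantsHypothesis.ValiantsHypothesis`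

namespace Summit.ValiantsHypothesis.ValiantsHypothesis.Theorems.TwoProducts.NonResonant

open scoped BigOperators Classical
open MvPolynomial

/-- If `K` exceeds the `x`-coordinate of `b`, the refined weight `K·wt + x` compares lexicographically. [folklore] -/
theorem refined_lt_imp {K : ℤ} {w : Fin 2 → ℤ} {a b : Fin 2 →₀ ℕ} (hbK : (b 0 : ℤ) < K)
    (h : K * (w 0 * (a 0 : ℤ) + w 1 * (a 1 : ℤ)) + (a 0 : ℤ) < K * (w 0 * (b 0 : ℤ) + w 1 * (b 1 : ℤ)) + (b 0 : ℤ)) :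
    w 0 * (a 0 : ℤ) + w 1 * (a 1 : ℤ) < w 0 * (b 0 : ℤ) + w 1 * (b 1 : ℤ) ∨
      (w 0 * (a 0 : ℤ) + w 1 * (a 1 : ℤ) = w 0 * (b 0 : ℤ) + w 1 * (b 1 : ℤ) ∧ a 0 < b 0) := by
  rcases lt_trichotomy (w 0 * (a 0 : ℤ) + w 1 * (a 1 : ℤ)) (w 0 * (b 0 : ℤ) + w 1 * (b 1 : ℤ)) with hlt | heq | hgt
  · exact Or.inl hlt
  · refine Or.inr ⟨heq, ?_⟩
    rw [heq] at h
    exact_mod_cast (lt_of_add_lt_add_left h)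
  · exact absurd h (not_lt.mpr (Pencil.K_separates (Nat.cast_nonneg _) hbK (Nat.cast_nonneg _) hgt).le)

/-- The refined weight is injective on points with `x`-coordinate below `K`, when `w 1 ≠ 0`. [folklore] -/
theorem refined_inj {K : ℤ} {w : Fin 2 → ℤ} (hw1 : w 1 ≠ 0) {a b : Fin 2 →₀ ℕ} (haK : (a 0 : ℤ) < K)
    (hbK : (b 0 : ℤ) < K)
    (h : K * (w 0 * (a 0 : ℤ) + w 1 * (a 1 : ℤ)) + (a 0 : ℤ) = K * (w 0 * (b 0 : ℤ) + w 1 * (b 1 : ℤ)) + (b 0 : ℤ)) :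
    a = b := by
  have hwt : w 0 * (a 0 : ℤ) + w 1 * (a 1 : ℤ) = w 0 * (b 0 : ℤ) + w 1 * (b 1 : ℤ) := by
    by_contra hne
    rcases lt_or_gt_of_ne hne with hlt | hlt
    · exact absurd h (Pencil.K_separates (Nat.cast_nonneg _) haK (Nat.cast_nonneg _) hlt).ne
    · exact absurd h.symm (Pencil.K_separates (Nat.cast_nonneg _) hbK (Nat.cast_nonneg _) hlt).ne
  have hx : ((a 0 : ℕ) : ℤ) = b 0 := by rw [hwt] at h; linarith
  have hy : ((a 1 : ℕ) : ℤ) = b 1 := by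
    rw [hx] at hwt
    have h2 : w 1 * ((a 1 : ℕ) : ℤ) = w 1 * (b 1 : ℤ) := by linarith
    exact mul_left_cancel₀ hw1 h2
  ext i
  fin_cases i
  · exact_mod_cast hx
  · exact_mod_cast hy

/-- Support of a tail `u − 1` when `u(0) = 1`. [folklore] -/
theorem support_sub_one {u : MvPolynomial (Fin 2) ℂ} (hu : coeff 0 u = 1) : (u - 1).support = u.support.erase 0 := by
  ext q
  rw [Finset.mem_erase, mem_support_iff, mem_support_iff, coeff_sub, coeff_one]
  by_cases hq : q = 0
  · subst hq; simp [hu]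
  · simp [Ne.symm hq, hq]

variable {n : ℕ}

/-- The tails `u_i − 1`, `v_i − 1` are supported in the letter set. [folklore] -/
theorem tails_support_subset (u v : Fin n → MvPolynomial (Fin 2) ℂ)
    (hu : ∀ i, coeff 0 (u i) = 1) (hv : ∀ i, coeff 0 (v i) = 1) :
    (Finset.univ.biUnion fun i => (Fin.append (fun i => u i - 1) (fun i => v i - 1) i).support) ⊆
      (Finset.univ.biUnion fun i => (u i).support.erase 0) ∪ (Finset.univ.biUnion fun i => (v i).support.erase 0) := by
  intro q hq
  obtain ⟨i, -, hi⟩ := Finset.mem_biUnion.mp hq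
  rw [Finset.mem_union]
  revert hi
  refine Fin.addCases (fun j hj => ?_) (fun j hj => ?_) i
  · left
    rw [Fin.append_left, support_sub_one (hu j)] at hj
    exact Finset.mem_biUnion.mpr ⟨j, Finset.mem_univ _, hj⟩
  · right
    rw [Fin.append_right, support_sub_one (hv j)] at hj
    exact Finset.mem_biUnion.mpr ⟨j, Finset.mem_univ _, hj⟩

/-- Zero is not a letter. [folklore] -/
theorem zero_notMem_letters (u v : Fin n → MvPolynomial (Fin 2) ℂ) : (0 : Fin 2 →₀ ℕ) ∉
    (Finset.univ.biUnion fun i => (u i).support.erase 0) ∪ (Finset.univ.biUnion fun i => (v i).support.erase 0) := by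
  simp

/-- Points of a finite set have `x`-coordinate below `1 + max x`. [folklore] -/
theorem lt_sup_add_one (U : Finset (Fin 2 →₀ ℕ)) {q : Fin 2 →₀ ℕ} (hq : q ∈ U) :
    ((q 0 : ℕ) : ℤ) < ((U.sup fun q => q 0 : ℕ) : ℤ) + 1 := by
  have : q 0 ≤ U.sup fun q => q 0 := Finset.le_sup (f := fun q : Fin 2 →₀ ℕ => q 0) hq
  exact_mod_cast Nat.lt_succ_of_le this

/-- Sums of single multisets evaluate as expected (size). [folklore] -/
theorem sum_singles_size {r : ℕ} (p : Fin r → (Fin 2 →₀ ℕ)) (j : Fin r → ℕ) :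
    ((∑ ρ, Finsupp.single (p ρ) (j ρ)).sum fun _ k => k) = ∑ ρ, j ρ := by
  rw [← Finsupp.sum_finsetSum_index (fun _ => rfl) (fun _ _ _ => rfl)]
  refine Finset.sum_congr rfl fun ρ _ => ?_
  rw [Finsupp.sum_single_index rfl]

/-- Sums of single multisets evaluate as expected (exponent). [folklore] -/
theorem sum_singles_phi {r : ℕ} (p : Fin r → (Fin 2 →₀ ℕ)) (j : Fin r → ℕ) :
    ((∑ ρ, Finsupp.single (p ρ) (j ρ)).sum fun a k => k • a) = ∑ ρ, j ρ • p ρ := by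
  rw [← Finsupp.sum_finsetSum_index (h := fun a k => k • a) (fun _ => zero_nsmul _)
    (fun _ _ _ => add_nsmul _ _ _)]
  refine Finset.sum_congr rfl fun ρ _ => ?_
  rw [Finsupp.sum_single_index (h := fun a k => k • a) (zero_nsmul _)]

/-- ECHELON DATA FOR A WEIGHT (the landed echelon stub at the refined weight `K·wt_w + x`, `K = 1 + max x` over the letters):
for `w 1 ≠ 0` there are `r ≤ 2n` generators of the tail span, supported in the letters, with pairwise distinct pivots that are
LEXICOGRAPHICALLY strict for `w`, every tail being a combination of them. [folklore] -/
theorem exists_lex_echelon (u v : Fin n → MvPolynomial (Fin 2) ℂ)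
    (hu : ∀ i, coeff 0 (u i) = 1) (hv : ∀ i, coeff 0 (v i) = 1) (w : Fin 2 → ℤ) (hw1 : w 1 ≠ 0) :
    ∃ (r : ℕ) (F : Fin r → MvPolynomial (Fin 2) ℂ) (a : Fin (n + n) → Fin r → ℂ) (p : Fin r → (Fin 2 →₀ ℕ)),
      r ≤ n + n ∧ (∀ i, Fin.append (fun i => u i - 1) (fun i => v i - 1) i = ∑ ρ, a i ρ • F ρ) ∧
      (∀ ρ, (F ρ).support ⊆
        (Finset.univ.biUnion fun i => (u i).support.erase 0) ∪ (Finset.univ.biUnion fun i => (v i).support.erase 0)) ∧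
      (∀ ρ, p ρ ∈ (F ρ).support ∧ ∀ q ∈ (F ρ).support, q ≠ p ρ →
        w 0 * (p ρ 0 : ℤ) + w 1 * (p ρ 1 : ℤ) < w 0 * (q 0 : ℤ) + w 1 * (q 1 : ℤ) ∨
          (w 0 * (p ρ 0 : ℤ) + w 1 * (p ρ 1 : ℤ) = w 0 * (q 0 : ℤ) + w 1 * (q 1 : ℤ) ∧ p ρ 0 < q 0)) ∧
      Function.Injective p := by
  set U := (Finset.univ.biUnion fun i => (u i).support.erase 0) ∪
    (Finset.univ.biUnion fun i => (v i).support.erase 0) with hU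
  set K : ℤ := ((U.sup fun q => q 0 : ℕ) : ℤ) + 1 with hK
  set g : Fin (n + n) → MvPolynomial (Fin 2) ℂ := Fin.append (fun i => u i - 1) (fun i => v i - 1) with hg
  set ω : (Fin 2 →₀ ℕ) → ℤ := fun q => K * (w 0 * (q 0 : ℤ) + w 1 * (q 1 : ℤ)) + (q 0 : ℤ) with hω
  have hsub : (Finset.univ.biUnion fun i => (g i).support) ⊆ U := tails_support_subset u v hu hv
  have hinjω : ∀ q ∈ (Finset.univ.biUnion fun i => (g i).support), ∀ q' ∈ (Finset.univ.biUnion fun i => (g i).support),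
      ω q = ω q' → q = q' := fun q hq q' hq' h =>
    refined_inj hw1 (lt_sup_add_one U (hsub hq)) (lt_sup_add_one U (hsub hq')) h
  obtain ⟨r, F, a, p, hr, htails, hsupp, hpiv, hinj⟩ := EchelonPivots.stub_echelonPivots (n + n) g ω hinjω
  refine ⟨r, F, a, p, hr, htails, fun ρ => (hsupp ρ).trans hsub, fun ρ => ⟨(hpiv ρ).1, fun q hq hne => ?_⟩, hinj⟩
  exact refined_lt_imp (lt_sup_add_one U (hsub ((hsupp ρ) hq))) ((hpiv ρ).2 q hq hne)

/-- **RUNG `stub_engineNonResonant`** (registered signature): non-resonant letter sets have at most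
`(|U|² + 2)·(2n+1)·4^{2n}` south-west vertices; composition of the landed `stub_echelonPivots` (p132414),
`stub_resonanceDichotomy` (p132489) and `stub_dissocCount`. [folklore] -/
theorem stub_engineNonResonant : ∀ (n : ℕ) (u v : Fin n → MvPolynomial (Fin 2) ℂ),
    (∀ i, MvPolynomial.coeff 0 (u i) = 1) → (∀ i, MvPolynomial.coeff 0 (v i) = 1) →
    (∀ (r : ℕ) (p : Fin r → (Fin 2 →₀ ℕ)) (Δ : Fin r → ℤ), Function.Injective p →
      (∀ ρ, p ρ ∈ ((Finset.univ.biUnion fun i => (u i).support.erase 0) ∪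
        (Finset.univ.biUnion fun i => (v i).support.erase 0))) →
      (∑ ρ, |Δ ρ|) ≤ 2 * n → (∃ ρ, Δ ρ ≠ 0) →
      ¬ ((∑ ρ, Δ ρ * (p ρ 0 : ℤ)) = 0 ∧ (∑ ρ, Δ ρ * (p ρ 1 : ℤ)) = 0)) →
    {e : Fin 2 →₀ ℕ | ∃ w : Fin 2 → ℤ, 0 < w 0 ∧ 0 < w 1 ∧ e ∈ (∏ i, u i - ∏ i, v i).support ∧
        ∀ e' ∈ (∏ i, u i - ∏ i, v i).support, e' ≠ e →
          w 0 * (e 0 : ℤ) + w 1 * (e 1 : ℤ) < w 0 * (e' 0 : ℤ) + w 1 * (e' 1 : ℤ)}.ncard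
      ≤ ((((Finset.univ.biUnion fun i => (u i).support.erase 0) ∪
            (Finset.univ.biUnion fun i => (v i).support.erase 0)).card) ^ 2 + 2) *
          ((2 * n + 1) * 4 ^ (2 * n)) := by
  intro n u v hu hv hNR
  set U := (Finset.univ.biUnion fun i => (u i).support.erase 0) ∪
    (Finset.univ.biUnion fun i => (v i).support.erase 0) with hU
  -- weak-order datum of a weight on `U`
  set wd : (Fin 2 → ℤ) → Finset ((Fin 2 →₀ ℕ) × (Fin 2 →₀ ℕ)) := fun w =>
    (U ×ˢ U).filter fun ab => w 0 * (ab.2 0 : ℤ) + w 1 * (ab.2 1 : ℤ) ≤ w 0 * (ab.1 0 : ℤ) + w 1 * (ab.1 1 : ℤ)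
    with hwd
  have hwd_eq : ∀ w w' : Fin 2 → ℤ,
      (∀ a ∈ U, ∀ b ∈ U, (w 0 * (b 0 : ℤ) + w 1 * (b 1 : ℤ) ≤ w 0 * (a 0 : ℤ) + w 1 * (a 1 : ℤ) ↔
        w' 0 * (b 0 : ℤ) + w' 1 * (b 1 : ℤ) ≤ w' 0 * (a 0 : ℤ) + w' 1 * (a 1 : ℤ))) → wd w = wd w' := by
    intro w w' h
    simp only [hwd]
    refine Finset.filter_congr ?_
    rintro ⟨a, b⟩ hab
    rw [Finset.mem_product] at hab
    exact h a hab.1 b hab.2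
  have hle_of_wd : ∀ w w' : Fin 2 → ℤ, wd w = wd w' → ∀ a ∈ U, ∀ b ∈ U,
      (w 0 * (b 0 : ℤ) + w 1 * (b 1 : ℤ) ≤ w 0 * (a 0 : ℤ) + w 1 * (a 1 : ℤ) ↔
        w' 0 * (b 0 : ℤ) + w' 1 * (b 1 : ℤ) ≤ w' 0 * (a 0 : ℤ) + w' 1 * (a 1 : ℤ)) := by
    intro w w' h a ha b hb
    have h1 : (a, b) ∈ wd w ↔ (a, b) ∈ wd w' := by rw [h]
    simpa [hwd, Finset.mem_filter, Finset.mem_product, ha, hb] using h1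
  -- the pivot-set function: pivots of the echelon datum of a chosen positive weight with the given weak order
  set RwD : Finset ((Fin 2 →₀ ℕ) × (Fin 2 →₀ ℕ)) → Finset (Fin 2 →₀ ℕ) := fun R =>
    if h : ∃ w' : Fin 2 → ℤ, (0 < w' 0 ∧ 0 < w' 1) ∧ wd w' = R then
      Finset.univ.image (exists_lex_echelon u v hu hv h.choose
        (ne_of_gt h.choose_spec.1.2)).choose_spec.choose_spec.choose_spec.choose
    else ∅ with hRwD
  set Rw : (Fin 2 → ℤ) → Finset (Fin 2 →₀ ℕ) := fun w => RwD (wd w) with hRw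
  have hRU : ∀ w, Rw w ⊆ U := by
    intro w q hq
    simp only [hRw, hRwD] at hq
    split_ifs at hq with h
    · obtain ⟨ρ, -, hρq⟩ := Finset.mem_image.mp hq
      have spec := (exists_lex_echelon u v hu hv h.choose
        (ne_of_gt h.choose_spec.1.2)).choose_spec.choose_spec.choose_spec.choose_spec
      rw [← hρq]
      exact spec.2.2.1 ρ (spec.2.2.2.1 ρ).1
    · exact absurd hq (Finset.notMem_empty _)
  have hRcard : ∀ w, (Rw w).card ≤ 2 * n := by
    intro w
    simp only [hRw, hRwD]
    split_ifs with h
    · have spec := (exists_lex_echelon u v hu hv h.choose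
        (ne_of_gt h.choose_spec.1.2)).choose_spec.choose_spec.choose_spec.choose_spec
      refine le_trans Finset.card_image_le ?_
      rw [Finset.card_univ, Fintype.card_fin]
      have := spec.1
      omega
    · simp
  have hRinv : ∀ w w' : Fin 2 → ℤ,
      (∀ a ∈ U, ∀ b ∈ U, (w 0 * (b 0 : ℤ) + w 1 * (b 1 : ℤ) ≤ w 0 * (a 0 : ℤ) + w 1 * (a 1 : ℤ) ↔
        w' 0 * (b 0 : ℤ) + w' 1 * (b 1 : ℤ) ≤ w' 0 * (a 0 : ℤ) + w' 1 * (a 1 : ℤ))) → Rw w = Rw w' := by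
    intro w w' hrel
    simp only [hRw]
    rw [hwd_eq w w' hrel]
  have hcount := DissocCount.stub_dissocCount (2 * n) U Rw hRU hRcard hRinv
  refine le_trans (Set.ncard_le_ncard ?_ ?_) hcount
  · -- every vertex is a small sum of pivots
    rintro e ⟨w, hw0, hw1, he, hmin⟩
    refine ⟨w, hw0, hw1, ?_⟩
    have hex : ∃ w' : Fin 2 → ℤ, (0 < w' 0 ∧ 0 < w' 1) ∧ wd w' = wd w := ⟨w, ⟨hw0, hw1⟩, rfl⟩
    set w' := hex.choose with hw'
    have hw'pos : 0 < w' 0 ∧ 0 < w' 1 := hex.choose_spec.1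
    have hdata : wd w' = wd w := hex.choose_spec.2
    have hw'1 : w' 1 ≠ 0 := ne_of_gt hw'pos.2
    set E := exists_lex_echelon u v hu hv w' hw'1 with hE
    obtain ⟨hr, htails, hsupp, hpiv, hinj⟩ := E.choose_spec.choose_spec.choose_spec.choose_spec
    set r := E.choose with hrdef
    set F := E.choose_spec.choose with hFdef
    set a := E.choose_spec.choose_spec.choose with hadef
    set p := E.choose_spec.choose_spec.choose_spec.choose with hpdef
    have hRwval : Rw w = Finset.univ.image p := by
      simp only [hRw, hRwD]
      rw [dif_pos hex]
    -- pivots are letters, lexicographically strict for `w` (same weak order as `w'`)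
    have hpU : ∀ ρ, p ρ ∈ U := fun ρ => (hsupp ρ) (hpiv ρ).1
    have hlex : ∀ ρ, p ρ ∈ (F ρ).support ∧ ∀ q ∈ (F ρ).support, q ≠ p ρ →
        w 0 * (p ρ 0 : ℤ) + w 1 * (p ρ 1 : ℤ) < w 0 * (q 0 : ℤ) + w 1 * (q 1 : ℤ) ∨
          (w 0 * (p ρ 0 : ℤ) + w 1 * (p ρ 1 : ℤ) = w 0 * (q 0 : ℤ) + w 1 * (q 1 : ℤ) ∧ p ρ 0 < q 0) := by
      intro ρ
      refine ⟨(hpiv ρ).1, fun q hq hne => ?_⟩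
      have h2 := (hpiv ρ).2 q hq hne
      have hab := hle_of_wd w' w hdata (p ρ) (hpU ρ) q ((hsupp ρ) hq)
      have hba := hle_of_wd w' w hdata q ((hsupp ρ) hq) (p ρ) (hpU ρ)
      rcases h2 with hlt | ⟨heq, hx⟩
      · left
        have : ¬ w' 0 * (q 0 : ℤ) + w' 1 * (q 1 : ℤ) ≤ w' 0 * (p ρ 0 : ℤ) + w' 1 * (p ρ 1 : ℤ) := not_le.mpr hlt
        exact not_le.mp (fun hle => this (hab.mpr hle))
      · right
        exact ⟨le_antisymm (hba.mp heq.le) (hab.mp heq.ge), hx⟩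
    have hF0 : ∀ ρ, MvPolynomial.coeff 0 (F ρ) = 0 := by
      intro ρ
      by_contra hne
      exact zero_notMem_letters u v ((hsupp ρ) (mem_support_iff.mpr hne))
    -- the factors in net form
    have hsmul : ∀ (i : Fin (n + n)), Fin.append (fun i => u i - 1) (fun i => v i - 1) i =
        ∑ ρ, MvPolynomial.C (a i ρ) * F ρ := by
      intro i
      rw [htails i]
      exact Finset.sum_congr rfl fun ρ _ => smul_eq_C_mul _ _
    have hufac : ∀ i, u i = 1 + ∑ ρ, MvPolynomial.C (a (Fin.castAdd n i) ρ) * F ρ := by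
      intro i
      have h1 : Fin.append (fun i => u i - 1) (fun i => v i - 1) (Fin.castAdd n i) = u i - 1 := by
        rw [Fin.append_left]
      rw [← hsmul, h1]; ring
    have hvfac : ∀ i, v i = 1 + ∑ ρ, MvPolynomial.C (a (Fin.natAdd n i) ρ) * F ρ := by
      intro i
      have h1 : Fin.append (fun i => u i - 1) (fun i => v i - 1) (Fin.natAdd n i) = v i - 1 := by
        rw [Fin.append_right]
      rw [← hsmul, h1]; ring
    have hD : (∏ i, u i - ∏ i, v i) = (∏ i, (1 + ∑ ρ, MvPolynomial.C (a (Fin.castAdd n i) ρ) * F ρ)) -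
        ∏ i, (1 + ∑ ρ, MvPolynomial.C (a (Fin.natAdd n i) ρ) * F ρ) := by
      rw [Finset.prod_congr rfl fun i _ => hufac i, Finset.prod_congr rfl fun i _ => hvfac i]
    rw [hD] at he hmin
    -- the dichotomy; the resonant alternative is excluded by hypothesis
    rcases ResonanceDichotomy.stub_resonanceDichotomy n r F (fun i => a (Fin.castAdd n i))
        (fun i => a (Fin.natAdd n i)) p w e hw0 hw1 hF0 hinj hlex ⟨he, hmin⟩ with
      ⟨j, hjn, hje⟩ | ⟨Δ, hΔne, hΔabs, hΔ0, hΔ1⟩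
    · refine ⟨∑ ρ, Finsupp.single (p ρ) (j ρ), ?_, ?_, ?_⟩
      · intro q hq
        rw [hRwval]
        obtain ⟨ρ, -, hρ⟩ := Finset.mem_biUnion.mp (Finsupp.support_finsetSum hq)
        have : q = p ρ := by
          have := Finsupp.support_single_subset hρ
          simpa using this
        exact Finset.mem_image.mpr ⟨ρ, Finset.mem_univ _, this.symm⟩
      · rw [sum_singles_size]; exact le_trans hjn (by omega)
      · rw [sum_singles_phi]; exact hje.symm
    · exact absurd ⟨hΔ0, hΔ1⟩ (hNR r p Δ hinj hpU hΔabs hΔne)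
  · -- finiteness of the comparison set: all its multisets lie in a box
    refine Set.Finite.subset ((Finset.Iic (∑ a ∈ U, Finsupp.single a (2 * n))).image
      (fun m : (Fin 2 →₀ ℕ) →₀ ℕ => m.sum fun a k => k • a)).finite_toSet ?_
    rintro e ⟨w, -, -, m, hmR, hdeg, hme⟩
    simp only [Finset.coe_image, Set.mem_image, Finset.mem_coe, Finset.mem_Iic]
    refine ⟨m, ?_, hme⟩
    intro a
    rw [Finsupp.finsetSum_apply]
    by_cases ha : a ∈ m.support
    · have haU : a ∈ U := hRU w (hmR ha)
      rw [Finset.sum_eq_single a (fun b _ hba => by rw [Finsupp.single_apply, if_neg hba])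
        (fun h => absurd haU h), Finsupp.single_eq_same]
      exact le_trans (Finsupp.le_degree a m) (by rw [Finsupp.degree_apply]; exact hdeg)
    · rw [Finsupp.notMem_support_iff.mp ha]
      exact Nat.zero_le _

end Summit.ValiantsHypothesis.ValiantsHypothesis.Theorems.TwoProducts.NonResonant
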